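import Summits.CriticalPhenomena.PercolationContinuityZ3.Theorems.PercNearOneGluingNoHeavyQuantLightTwoBlobFlow
import HarnessLib

/-!
# QUANT lane R8, T-DEC: the two-blob law with ONLY ATOM `0` LOW — the capacity-proportional flow as a `LawDec.FlowAtT` datum
# (structural lemma for sub-case O of the light–light two-blob law; the same flow as typer g22's `lightTwoBlob_decAtT_caseO`)

builds on p205010 (kernel theorem, internal audit signed; external expert review pending)

Support file (`--supports stmt-CriticalPhenomena-4575`), QUANT lane typer seat prim-quant-stmt (gen 23), rung R8 of
`run/shared/lean/prim/quant/LADDER.md`.  Theorems only, standard axioms, no sorries.  Companion of `…QuantLightTwoBlobFlow`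
(`LawDec.twoBlob_decAtT_of_lowFlow`: one low blob atom).

* **`LawDec.twoBlob_decAtT_of_zeroFlow`** — law `LAW2[p, u; q, v]` (atoms `0, p, q, p+q`), floor `0 < x < 1`, gates in `[0,1]`, `1 ≤ p`, `1 ≤ q`,
  `p + q ≤ j″`, target `0 < T` with `T ≤ 2p`, `T ≤ 2q` (both blob atoms self-sufficient) and `T < p + q`; flows of atom `0`: `Fp, Fq, Fs ≥ 0`
  with `Fp + Fq + Fs = (1−u)(1−v)`, `0 < Fp → T < p ∧ usage(0,p)·Fp ≤ u(1−v)`, `0 < Fq → T < q ∧ usage(0,q)·Fq ≤ (1−u)v`,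
  `usage(0,p+q)·Fs ≤ uv` ⟹ `DECAtT x T j″ (p+q) LAW2[p, u; q, v]` (via `LawDec.decAtT_of_flowAtT`).  Works for `p = q` too.
* **`LawDec.twoBlob_decAtT_of_capacity`** — the same from the CAPACITY INEQUALITY: numbers `Cp, Cq ≥ 0` with `Cp = 0 ∨ (T < p ∧
  Cp·usage(0,p) ≤ u(1−v))`, `Cq = 0 ∨ (T < q ∧ Cq·usage(0,q) ≤ (1−u)v)`, and `(1−u)(1−v) ≤ Cp + Cq + uv/usage(0,p+q)` ⟹ DEC
  (flows proportional to the capacities).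

[this work]; DEC rules ARCH-TREES-G49 §2.2 / DEC-TAMP-G50 §3.1, flow normal form `…QuantLawDecFlows` (this lane).  The gluing rows served
[cite: KozmaNitzan2024, Conjecture 3 (p. 15)]; product measure [cite: Grimmett1999, §1.3 p. 10].
-/

noncomputable section

namespace Summit.CriticalPhenomena.PercolationContinuityZ3.Theorems

namespace Quant

open Finset

/-- the two-blob law `(1−u)(1−v)δ₀ + u(1−v)δ_a + (1−u)vδ_b + uvδ_{a+b}` evaluated at `h` (as in `…QuantBlobDecTwoLawParts`) -/
local notation3 "LAW2[" a ", " u ", " b ", " v ", " h "]" =>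
  (1 - (u : ℝ)) * (1 - (v : ℝ)) * (if (h : ℕ) = 0 then (1 : ℝ) else 0)
    + (u : ℝ) * (1 - (v : ℝ)) * (if (h : ℕ) = (a : ℕ) then (1 : ℝ) else 0)
    + (1 - (u : ℝ)) * (v : ℝ) * (if (h : ℕ) = (b : ℕ) then (1 : ℝ) else 0)
    + (u : ℝ) * (v : ℝ) * (if (h : ℕ) = (a : ℕ) + (b : ℕ) then (1 : ℝ) else 0)

namespace LawDec

/-- **DEC OF THE TWO-BLOB LAW WHEN ONLY ATOM `0` IS LOW, FROM AN EXPLICIT FLOW OF ATOM `0`** into the three absorbers `p`, `q`, `p + q`.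
See the file header. [this work] -/
theorem twoBlob_decAtT_of_zeroFlow (x u v T Fp Fq Fs : ℝ) (p q j'' : ℕ) (hx0 : 0 < x) (hx1 : x < 1) (hu0 : 0 ≤ u) (hu1 : u ≤ 1)
    (hv0 : 0 ≤ v) (hv1 : v ≤ 1) (hp : 1 ≤ p) (hq : 1 ≤ q) (hj : p + q ≤ j'') (hT0 : 0 < T) (hTp : T ≤ 2 * (p : ℝ))
    (hTq : T ≤ 2 * (q : ℝ)) (hTpq : T < (p : ℝ) + q)
    (hFp0 : 0 ≤ Fp) (hFq0 : 0 ≤ Fq) (hFs0 : 0 ≤ Fs) (hsum : Fp + Fq + Fs = (1 - u) * (1 - v))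
    (hFp : 0 < Fp → T < (p : ℝ) ∧ usage x T j'' 0 p * Fp ≤ u * (1 - v))
    (hFq : 0 < Fq → T < (q : ℝ) ∧ usage x T j'' 0 q * Fq ≤ (1 - u) * v)
    (hFs : usage x T j'' 0 (p + q) * Fs ≤ u * v) :
    DECAtT x T j'' (p + q) (fun h => LAW2[p, u, q, v, h]) := by
  classical
  set f : ℕ → ℕ → ℝ := fun l h =>
    (Fp * (if h = p then (1:ℝ) else 0) + Fq * (if h = q then (1:ℝ) else 0) + Fs * (if h = p + q then (1:ℝ) else 0))
      * (if l = 0 then (1:ℝ) else 0) with hf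
  have ind_nn : ∀ (P : Prop) [Decidable P], (0:ℝ) ≤ (if P then (1:ℝ) else 0) := fun P _ => by split_ifs <;> norm_num
  refine decAtT_of_flowAtT x T j'' (p + q) _ hx0 hx1 (fun h hh => BlobDec2.law_eq_zero_of_lt p q u v h hh)
    (BlobDec2.law_mass p q u v) ⟨f, ?_, ?_, ?_, ?_⟩
  · intro l h
    simp only [hf]
    refine mul_nonneg ?_ (ind_nn _)
    have := mul_nonneg hFp0 (ind_nn (h = p)); have := mul_nonneg hFq0 (ind_nn (h = q))
    have := mul_nonneg hFs0 (ind_nn (h = p + q))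
    linarith
  · -- support: (0, p) [Fp > 0], (0, q) [Fq > 0], (0, p+q)
    intro l h hpos
    simp only [hf] at hpos
    by_cases hl0 : l = 0
    · rw [if_pos hl0, mul_one] at hpos
      have hhle : h ≤ p + q := by
        by_contra hh
        rw [if_neg (show h ≠ p by omega), if_neg (show h ≠ q by omega), if_neg (show h ≠ p + q by omega)] at hpos
        simp at hpos
      have key : T < (h : ℝ) := by
        by_contra hcon
        push Not at hcon
        have e1 : Fp * (if h = p then (1:ℝ) else 0) = 0 := by
          by_cases hh : h = p
          · rw [if_pos hh, mul_one]
            by_contra hne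
            have hFpos : 0 < Fp := lt_of_le_of_ne hFp0 (Ne.symm hne)
            have := (hFp hFpos).1
            rw [← hh] at this
            linarith
          · rw [if_neg hh, mul_zero]
        have e2 : Fq * (if h = q then (1:ℝ) else 0) = 0 := by
          by_cases hh : h = q
          · rw [if_pos hh, mul_one]
            by_contra hne
            have hFpos : 0 < Fq := lt_of_le_of_ne hFq0 (Ne.symm hne)
            have := (hFq hFpos).1
            rw [← hh] at this
            linarith
          · rw [if_neg hh, mul_zero]
        have e3 : Fs * (if h = p + q then (1:ℝ) else 0) = 0 := by
          have hh : h ≠ p + q := by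
            rintro rfl
            push_cast at hcon
            linarith
          rw [if_neg hh, mul_zero]
        rw [e1, e2, e3] at hpos
        linarith
      refine ⟨by omega, by rw [hl0]; simpa using hT0, hhle, Or.inr ?_⟩
      rw [hl0]; push_cast; linarith
    · rw [if_neg hl0, mul_zero] at hpos; exact absurd hpos (lt_irrefl 0)
  · -- the only low atom is 0
    intro l hlj hlow
    have hsum' : ∑ h ∈ Finset.range (p + q + 1), f l h
        = (Fp + Fq + Fs) * (if l = 0 then (1:ℝ) else 0) := by
      have e : ∀ h, f l h = (if l = 0 then (1:ℝ) else 0) * Fp * (if h = p then (1:ℝ) else 0)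
          + (if l = 0 then (1:ℝ) else 0) * Fq * (if h = q then (1:ℝ) else 0)
          + (if l = 0 then (1:ℝ) else 0) * Fs * (if h = p + q then (1:ℝ) else 0) := fun h => by simp only [hf]; ring
      simp only [e, Finset.sum_add_distrib]
      rw [BlobDec2.sum_range_const_indicator _ p (by omega), BlobDec2.sum_range_const_indicator _ q (by omega),
        BlobDec2.sum_range_const_indicator _ (p + q) le_rfl]
      ring
    rw [hsum', hsum]
    dsimp only
    have hlp : l ≠ p := by rintro rfl; linarith
    have hlq : l ≠ q := by rintro rfl; linarith
    have hlpq : l ≠ p + q := by rintro rfl; push_cast at hlow; linarith [(Nat.cast_nonneg p : (0:ℝ) ≤ p)]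
    by_cases hl0 : l = 0
    · rw [if_pos hl0, if_neg hlp, if_neg hlq, if_neg hlpq]; ring
    · rw [if_neg hl0, if_neg hlp, if_neg hlq, if_neg hlpq]; ring
  · -- absorbers
    intro h hhM hself
    have hsum' : ∑ l ∈ Finset.range (j'' + 1), usage x T j'' l h * f l h
        = usage x T j'' 0 h * (Fp * (if h = p then (1:ℝ) else 0) + Fq * (if h = q then (1:ℝ) else 0)
            + Fs * (if h = p + q then (1:ℝ) else 0)) := by
      have e : ∀ l, usage x T j'' l h * f l h
          = (usage x T j'' 0 h * (Fp * (if h = p then (1:ℝ) else 0) + Fq * (if h = q then (1:ℝ) else 0)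
            + Fs * (if h = p + q then (1:ℝ) else 0))) * (if l = 0 then (1:ℝ) else 0) := by
        intro l; simp only [hf]
        by_cases hl0 : l = 0
        · rw [if_pos hl0, hl0]; ring
        · rw [if_neg hl0]; ring
      simp only [e]
      rw [BlobDec2.sum_range_const_indicator _ 0 (Nat.zero_le _)]
    rw [hsum']
    dsimp only
    have hh0 : h ≠ 0 := by
      rintro rfl
      rcases hself with h1 | h1
      · omega
      · simp at h1; linarith
    have hmp : 0 ≤ u * (1 - v) := mul_nonneg hu0 (by linarith)
    have hmq : 0 ≤ (1 - u) * v := mul_nonneg (by linarith) hv0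
    have hms : 0 ≤ u * v := mul_nonneg hu0 hv0
    -- value of the bound at each absorber
    have hFp' : usage x T j'' 0 p * Fp ≤ u * (1 - v) := by
      rcases hFp0.eq_or_lt with hz | hpos
      · rw [← hz, mul_zero]; exact hmp
      · exact (hFp hpos).2
    have hFq' : usage x T j'' 0 q * Fq ≤ (1 - u) * v := by
      rcases hFq0.eq_or_lt with hz | hpos
      · rw [← hz, mul_zero]; exact hmq
      · exact (hFq hpos).2
    rw [if_neg hh0]
    by_cases hhp : h = p
    · rw [if_pos hhp]
      by_cases hhq : h = q
      · -- p = q: the atom carries both masses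
        rw [if_pos hhq, if_neg (show h ≠ p + q by omega)]
        simp only [mul_one, mul_zero, add_zero, zero_add]
        rw [mul_add]
        have e1 : usage x T j'' 0 h = usage x T j'' 0 p := by rw [hhp]
        have e2 : usage x T j'' 0 h = usage x T j'' 0 q := by rw [hhq]
        nlinarith [hFp', hFq', e1, e2, mul_nonneg (sub_nonneg.2 hu1) (sub_nonneg.2 hv1), ind_nn (h = 0)]
      · rw [if_neg hhq, if_neg (show h ≠ p + q by omega)]
        simp only [mul_one, mul_zero, add_zero]
        rw [hhp]; linarith [hFp']
    · rw [if_neg hhp]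
      by_cases hhq : h = q
      · rw [if_pos hhq, if_neg (show h ≠ p + q by omega)]
        simp only [mul_one, mul_zero, add_zero, zero_add]
        rw [hhq]; linarith [hFq']
      · rw [if_neg hhq]
        by_cases hhs : h = p + q
        · rw [if_pos hhs]
          simp only [mul_one, mul_zero, zero_add]
          rw [hhs]; linarith [hFs]
        · rw [if_neg hhs]
          simp only [mul_zero, add_zero]
          rfl

/-- **DEC OF THE TWO-BLOB LAW WHEN ONLY ATOM `0` IS LOW, FROM THE CAPACITY INEQUALITY** (flows proportional to the capacities
`Cp`, `Cq`, `Cs = uv/usage(0,p+q)`).  See the file header. [this work] -/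
theorem twoBlob_decAtT_of_capacity (x u v T Cp Cq : ℝ) (p q j'' : ℕ) (hx0 : 0 < x) (hx1 : x < 1) (hu0 : 0 ≤ u) (hu1 : u ≤ 1)
    (hv0 : 0 ≤ v) (hv1 : v ≤ 1) (hp : 1 ≤ p) (hq : 1 ≤ q) (hj : p + q ≤ j'') (hT0 : 0 < T) (hTp : T ≤ 2 * (p : ℝ))
    (hTq : T ≤ 2 * (q : ℝ)) (hTpq : T < (p : ℝ) + q) (hCp0 : 0 ≤ Cp) (hCq0 : 0 ≤ Cq)
    (hCp : Cp = 0 ∨ (T < (p : ℝ) ∧ Cp * usage x T j'' 0 p ≤ u * (1 - v)))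
    (hCq : Cq = 0 ∨ (T < (q : ℝ) ∧ Cq * usage x T j'' 0 q ≤ (1 - u) * v))
    (hcap : (1 - u) * (1 - v) ≤ Cp + Cq + u * v / usage x T j'' 0 (p + q)) :
    DECAtT x T j'' (p + q) (fun h => LAW2[p, u, q, v, h]) := by
  have hus : 0 < usage x T j'' 0 (p + q) := by
    simp only [usage, gateOf, if_neg (show ¬ (j'' + 1 ≤ p + q) by omega)]
    have hg0 := pairGate_pos x T 0 (p + q) (by simpa using hT0) (by omega)
    have hg1 := pairGate_lt_one x T 0 (p + q) hx0 hx1 (by simpa using hT0) (by push_cast; simpa using hTpq)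
    exact div_pos hg0 (by linarith)
  set Cs : ℝ := u * v / usage x T j'' 0 (p + q) with hCs
  have hCs0 : 0 ≤ Cs := div_nonneg (mul_nonneg hu0 hv0) hus.le
  set C : ℝ := Cp + Cq + Cs with hC
  set m0 : ℝ := (1 - u) * (1 - v) with hm0
  have hm00 : 0 ≤ m0 := mul_nonneg (by linarith) (by linarith)
  rcases hm00.eq_or_lt with hz | hm0pos
  · -- no low mass at all: the zero flow
    refine twoBlob_decAtT_of_zeroFlow x u v T 0 0 0 p q j'' hx0 hx1 hu0 hu1 hv0 hv1 hp hq hj hT0 hTp hTq hTpq le_rfl le_rfl le_rfl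
      (by rw [← hm0, ← hz]; ring) (fun h => absurd h (lt_irrefl 0)) (fun h => absurd h (lt_irrefl 0)) ?_
    rw [mul_zero]; exact mul_nonneg hu0 hv0
  have hCpos : 0 < C := lt_of_lt_of_le hm0pos hcap
  have hratio : m0 / C ≤ 1 := by rw [div_le_one hCpos]; exact hcap
  have hratio0 : 0 ≤ m0 / C := div_nonneg hm00 hCpos.le
  refine twoBlob_decAtT_of_zeroFlow x u v T (m0 / C * Cp) (m0 / C * Cq) (m0 / C * Cs) p q j'' hx0 hx1 hu0 hu1 hv0 hv1 hp hq hj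
    hT0 hTp hTq hTpq (mul_nonneg hratio0 hCp0) (mul_nonneg hratio0 hCq0) (mul_nonneg hratio0 hCs0) ?_ ?_ ?_ ?_
  · rw [← mul_add, ← mul_add, ← hC, div_mul_cancel₀ _ hCpos.ne']
  · intro hpos
    rcases hCp with hz | ⟨hTp', hle⟩
    · rw [hz, mul_zero] at hpos; exact absurd hpos (lt_irrefl 0)
    · refine ⟨hTp', ?_⟩
      calc usage x T j'' 0 p * (m0 / C * Cp) = (m0 / C) * (Cp * usage x T j'' 0 p) := by ring
        _ ≤ 1 * (u * (1 - v)) := mul_le_mul hratio hle (by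
            have := pairGate_pos x T 0 p (by simpa using hT0) (by omega)
            have h1 := pairGate_lt_one x T 0 p hx0 hx1 (by simpa using hT0) (by simpa using hTp')
            have : 0 ≤ usage x T j'' 0 p := by
              simp only [usage, gateOf, if_neg (show ¬ (j'' + 1 ≤ p) by omega)]
              exact div_nonneg this.le (by linarith)
            exact mul_nonneg hCp0 this) zero_le_one
        _ = u * (1 - v) := one_mul _
  · intro hpos
    rcases hCq with hz | ⟨hTq', hle⟩
    · rw [hz, mul_zero] at hpos; exact absurd hpos (lt_irrefl 0)
    · refine ⟨hTq', ?_⟩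
      calc usage x T j'' 0 q * (m0 / C * Cq) = (m0 / C) * (Cq * usage x T j'' 0 q) := by ring
        _ ≤ 1 * ((1 - u) * v) := mul_le_mul hratio hle (by
            have := pairGate_pos x T 0 q (by simpa using hT0) (by omega)
            have h1 := pairGate_lt_one x T 0 q hx0 hx1 (by simpa using hT0) (by simpa using hTq')
            have : 0 ≤ usage x T j'' 0 q := by
              simp only [usage, gateOf, if_neg (show ¬ (j'' + 1 ≤ q) by omega)]
              exact div_nonneg this.le (by linarith)
            exact mul_nonneg hCq0 this) zero_le_one
        _ = (1 - u) * v := one_mul _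
  · calc usage x T j'' 0 (p + q) * (m0 / C * Cs) = (m0 / C) * (u * v) := by
          rw [hCs]; field_simp
      _ ≤ 1 * (u * v) := mul_le_mul_of_nonneg_right hratio (mul_nonneg hu0 hv0)
      _ = u * v := one_mul _

end LawDec

end Quant

end Summit.CriticalPhenomena.PercolationContinuityZ3.Theorems
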